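import Mathlib.GroupTheory.PresentedGroup
import Mathlib.GroupTheory.OrderOfElement
import Mathlib.GroupTheory.Index
import Mathlib.GroupTheory.SemidirectProduct
import Mathlib.Data.ZMod.Basic
import Mathlib.Data.ZMod.QuotientGroup
import Mathlib.Algebra.Group.TypeTags.Finite
import Mathlib.Algebra.Group.Subgroup.Finite
import Mathlib.Tactic.Ring
import Literature.GroupTheory.CombinatorialGroupTheory.PuncturedSurfaceGroupCusps
import HarnessLib

/-!
# Transitive actions of `Γ_{g,r}` on `ℓ²` points with all cusps acting freely ([SemiAnbd] Ex. 2.10 (3))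

Mochizuki, *Semi-graphs of anabelioids*, Publ. RIMS **42** (2006), Example 2.10 p. 31: the
semi-graph of anabelioids of a pointed stable curve is "… totally universally sub-coverticial …"
([SemiAnbd] Def. 2.4 (iii) p. 25: every closed edge `e` splits, in a suitable finite étale covering,
into two distinct coverticial edges).  A finite étale covering of a semi-graph of anabelioids of
surface type is an object `{S_v, T_e, ψ_b}` of `B(𝒢)`: finite `Π_v`-sets `S_v` whose restrictions
to the two branch (cusp inertia, procyclic) groups of every edge are isomorphic — i.e. the two cusp
generators act with the SAME CYCLE TYPE (the identification of `Π_e` with a cusp inertia group is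
only canonical up to a unit of `Ẑ^Σ`, which does not change cycle types).  The covering splits `e`
into coverticial edges as soon as `S_v`, `S_w` are transitive at the end-points `v`, `w` of `e` and
the branch generators of `e` act with `≥ 2` cycles.  This proof-only file (cell abc-iut, layer L3,
row G31 (3), seat abc-iut-L3-t4) supplies the uniform group theory: for EVERY hyperbolic type
`(g, r)` and every prime `ℓ`, a surjection `f : Γ_{g,r} ↠ G` onto a group of order dividing `ℓ³`
and a subgroup `H ⊆ G` of index `ℓ²` such that no conjugate of any `f(c_j)` lies in `H` and
`f(c_j)^ℓ = 1` — so `Γ_{g,r}` acts transitively on the `ℓ²` cosets `G/H` and every cusp generator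
acts freely with all its cycles of length exactly `ℓ` (`exists_hom_transitive_cusps_free`): for
`r ≠ 1` the regular action of `(ℤ/ℓ)²`, for `r = 1` the Heisenberg group mod `ℓ` acting on the
cosets of a non-central subgroup of order `ℓ`.  Plain combinatorial group theory; no statement here
takes a side on any disputed claim.
-/

namespace Literature.GroupTheory.CombinatorialGroupTheory.PuncturedSurfaceGroup

open Multiplicative

variable {g r : ℕ}

/-! ### `r ≠ 1`: the regular action of `(ℤ/ℓ)²` -/

/-- In `ℤ/ℓ × ℤ/ℓ` every element is killed by `ℓ`. [folklore] -/
private theorem nsmul_self_eq_zero (ℓ : ℕ) (x : ZMod ℓ × ZMod ℓ) : ℓ • x = 0 := by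
  ext <;> simp [nsmul_eq_mul]

/-- A homomorphism to `ℤ/ℓ × ℤ/ℓ` hitting `(1,0)` and `(0,1)` is surjective. [folklore] -/
private theorem surjective_of_hits {Γ : Type*} [Group Γ] {ℓ : ℕ} [NeZero ℓ]
    (f : Γ →* Multiplicative (ZMod ℓ × ZMod ℓ)) (u v : Γ) (hu : f u = ofAdd (1, 0))
    (hv : f v = ofAdd (0, 1)) : Function.Surjective f := by
  intro y
  refine ⟨u ^ (toAdd y).1.val * v ^ (toAdd y).2.val, ?_⟩
  rw [map_mul, map_pow, map_pow, hu, hv, ← ofAdd_nsmul, ← ofAdd_nsmul, ← ofAdd_add, Prod.smul_mk,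
    Prod.smul_mk, smul_zero, smul_zero, nsmul_eq_mul, nsmul_eq_mul, mul_one, mul_one,
    ZMod.natCast_zmod_val, ZMod.natCast_zmod_val, Prod.mk_add_mk, add_zero, zero_add]
  exact ofAdd_toAdd y

/-- **`r ≠ 1`.** For `(g, r)` hyperbolic with `r ≠ 1` and `ℓ` prime: a surjection
`f : Γ_{g,r} ↠ ℤ/ℓ × ℤ/ℓ` with every `f(c_j) ≠ 0` — `a_i ↦ (1,0)`, `b_i ↦ (0,1)`,
`c_j ↦ (1,0)` (`j < r-2`), `c_{r-2} ↦ (0,1)`, `c_{r-1} ↦ (-(r-2), -1)`.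
[cite: MochizukiSemiAnbd2006, Ex. 2.10 p.31] -/
theorem exists_hom_zmod_sq_surjective (h : IsHyperbolicType g r) (hr : r ≠ 1) {ℓ : ℕ}
    (hℓ : ℓ.Prime) :
    ∃ f : PuncturedSurfaceGroup g r →* Multiplicative (ZMod ℓ × ZMod ℓ),
      Function.Surjective f ∧ ∀ j, f (c j) ≠ 1 := by
  haveI : NeZero ℓ := ⟨hℓ.ne_zero⟩
  haveI : Fact (1 < ℓ) := ⟨hℓ.one_lt⟩
  -- the images of the cusp generators
  let C : ℕ → Multiplicative (ZMod ℓ × ZMod ℓ) := fun j =>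
    if j + 2 < r then ofAdd (1, 0) else if j + 2 = r then ofAdd (0, 1)
      else ofAdd (-((r - 2 : ℕ) : ZMod ℓ), -1)
  have hCne : ∀ j, C j ≠ 1 := by
    intro j
    simp only [C]
    split_ifs
    · rw [Ne, ofAdd_eq_one, Prod.mk_eq_zero]; exact fun h' => one_ne_zero h'.1
    · rw [Ne, ofAdd_eq_one, Prod.mk_eq_zero]; exact fun h' => one_ne_zero h'.2
    · rw [Ne, ofAdd_eq_one, Prod.mk_eq_zero]; exact fun h' => (neg_ne_zero.2 one_ne_zero) h'.2
  let F : puncturedSurfaceGen g r → Multiplicative (ZMod ℓ × ZMod ℓ) :=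
    Sum.elim (fun ib => if ib.2 then ofAdd (0, 1) else ofAdd (1, 0)) fun j => C j.val
  have hrel : ∀ w ∈ ({relator g r} : Set (FreeGroup (puncturedSurfaceGen g r))),
      FreeGroup.lift F w = 1 := by
    intro w hw
    rw [Set.mem_singleton_iff] at hw
    rw [hw, lift_relator]
    have h1 : ((List.finRange g).map fun i =>
        F (Sum.inl (i, false)) * F (Sum.inl (i, true)) * (F (Sum.inl (i, false)))⁻¹ *
          (F (Sum.inl (i, true)))⁻¹).prod = 1 :=
      List.prod_eq_one fun y hy => by
        obtain ⟨i, -, rfl⟩ := List.mem_map.mp hy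
        rw [mul_inv_cancel_comm, mul_inv_cancel]
    have h2 : ((List.finRange r).map fun j => F (Sum.inr j)).prod = 1 := by
      rw [← Fin.prod_univ_def]
      change (∏ j : Fin r, C j.val) = 1
      rcases Nat.lt_or_ge r 2 with hr2 | hr2
      · have hr0 : r = 0 := by omega
        subst hr0
        rfl
      · obtain ⟨m, rfl⟩ : ∃ m, r = m + 2 := ⟨r - 2, by omega⟩
        rw [Fin.prod_univ_castSucc, Fin.prod_univ_castSucc]
        have hlt : ∀ j : Fin m, C (j.castSucc.castSucc).val = ofAdd (1, 0) := fun j => by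
          simp only [C, Fin.val_castSucc]
          rw [if_pos (by omega)]
        have hm1 : C (Fin.last m).castSucc.val = ofAdd (0, 1) := by
          simp only [C, Fin.val_castSucc, Fin.val_last]
          rw [if_neg (by omega), if_pos trivial]
        have hm2 : C (Fin.last (m + 1)).val = ofAdd (-(m : ZMod ℓ), -1) := by
          simp only [C, Fin.val_last]
          rw [if_neg (by omega), if_neg (by omega), Nat.add_sub_cancel]
        rw [Finset.prod_congr rfl fun j _ => hlt j, Finset.prod_const, Finset.card_univ,
          Fintype.card_fin, hm1, hm2, ← ofAdd_nsmul, ← ofAdd_add, ← ofAdd_add, Prod.smul_mk,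
          smul_zero, nsmul_eq_mul, mul_one, Prod.mk_add_mk, Prod.mk_add_mk]
        simp
    rw [h1, h2, one_mul]
  have hc : ∀ j, PresentedGroup.toGroup hrel (c j) = C j.val := fun j => by
    rw [c, PresentedGroup.toGroup.of]; rfl
  refine ⟨PresentedGroup.toGroup hrel, ?_, fun j => by rw [hc]; exact hCne _⟩
  -- surjectivity: `(1,0)` and `(0,1)` are hit (by `a₀, b₀` if `g ≥ 1`, else by `c₀, c_{r-2}`)
  rcases Nat.eq_zero_or_pos g with hg | hg
  · subst hg
    have hr3 : 3 ≤ r := by unfold IsHyperbolicType at h; omega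
    refine surjective_of_hits _ (c ⟨0, by omega⟩) (c ⟨r - 2, by omega⟩) ?_ ?_
    · rw [hc]; simp only [C]; rw [if_pos (by omega)]
    · rw [hc]; simp only [C]; rw [if_neg (by omega), if_pos (by omega)]
  · refine surjective_of_hits _ (a ⟨0, hg⟩) (b ⟨0, hg⟩) ?_ ?_
    · rw [a, PresentedGroup.toGroup.of]; rfl
    · rw [b, PresentedGroup.toGroup.of]; rfl

/-! ### `r = 1`: the Heisenberg group mod `ℓ` -/

/-- **`r = 1`** (so `g ≥ 1`): a SURJECTION `f : Γ_{g,1} ↠ H_ℓ = (ℤ/ℓ × ℤ/ℓ) ⋊ ℤ/ℓ` onto the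
Heisenberg group mod `ℓ` (the factor `ℤ/ℓ` acting by shears `t · (p, q) = (p, q + tp)`),
`a₁ ↦ x = (0; 1)`, `b₁ ↦ y = ((1,0); 0)`, other `aᵢ, bᵢ ↦ 1`, `c₁ ↦ [x,y]⁻¹ = ((0,1); 0)⁻¹` (a
central element). [cite: MochizukiSemiAnbd2006, Ex. 2.10 p.31] -/
theorem exists_hom_heisenberg_surjective (hg : 0 < g) (ℓ : ℕ) [NeZero ℓ] :
    ∃ (σ : Multiplicative (ZMod ℓ) →* MulAut (Multiplicative (ZMod ℓ × ZMod ℓ)))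
      (f : PuncturedSurfaceGroup g 1 →*
        (Multiplicative (ZMod ℓ × ZMod ℓ) ⋊[σ] Multiplicative (ZMod ℓ))),
      (∀ (t : Multiplicative (ZMod ℓ)) (p q : ZMod ℓ),
        σ t (ofAdd (p, q)) = ofAdd (p, q + t.toAdd * p)) ∧
      Function.Surjective f ∧ f (c 0) = (SemidirectProduct.inl (ofAdd (0, 1)))⁻¹ := by
  obtain ⟨g', rfl⟩ : ∃ g', g = g' + 1 := ⟨g - 1, by omega⟩
  let σ : Multiplicative (ZMod ℓ) →* MulAut (Multiplicative (ZMod ℓ × ZMod ℓ)) :=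
    { toFun := fun t =>
        { toFun := fun q => ofAdd (q.toAdd.1, q.toAdd.2 + t.toAdd * q.toAdd.1)
          invFun := fun q => ofAdd (q.toAdd.1, q.toAdd.2 - t.toAdd * q.toAdd.1)
          left_inv := fun q => by simp
          right_inv := fun q => by simp
          map_mul' := fun q q' => by
            rw [← ofAdd_add, Prod.mk_add_mk, toAdd_mul, Prod.fst_add, Prod.snd_add]
            exact congrArg ofAdd (Prod.ext rfl (by dsimp only; ring)) }
      map_one' := by
        ext q
        · simp
        · simp
      map_mul' := fun t t' => by
        ext q
        · simp
        · simp only [toAdd_mul, MulAut.mul_apply, MulEquiv.coe_mk, Equiv.coe_fn_mk, toAdd_ofAdd]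
          ring }
  have hσ : ∀ (t : Multiplicative (ZMod ℓ)) (p q : ZMod ℓ),
      σ t (ofAdd (p, q)) = ofAdd (p, q + t.toAdd * p) := fun _ _ _ => rfl
  let x : Multiplicative (ZMod ℓ × ZMod ℓ) ⋊[σ] Multiplicative (ZMod ℓ) :=
    SemidirectProduct.inr (ofAdd 1)
  let y : Multiplicative (ZMod ℓ × ZMod ℓ) ⋊[σ] Multiplicative (ZMod ℓ) :=
    SemidirectProduct.inl (ofAdd (1, 0))
  let z : Multiplicative (ZMod ℓ × ZMod ℓ) ⋊[σ] Multiplicative (ZMod ℓ) :=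
    SemidirectProduct.inl (ofAdd (0, 1))
  have hxyx : x * y * x⁻¹ = SemidirectProduct.inl (ofAdd ((1 : ZMod ℓ), (1 : ZMod ℓ))) := by
    rw [← map_inv, ← SemidirectProduct.inl_aut, hσ]
    simp
  have hz : x * y * x⁻¹ * y⁻¹ = z := by
    rw [hxyx, ← map_inv, ← map_mul, ← ofAdd_neg, ← ofAdd_add, Prod.neg_mk, Prod.mk_add_mk]
    simp [z]
  let F : puncturedSurfaceGen (g' + 1) 1 →
      Multiplicative (ZMod ℓ × ZMod ℓ) ⋊[σ] Multiplicative (ZMod ℓ) :=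
    Sum.elim (fun ib => if ib.1 = 0 then (if ib.2 then y else x) else 1) fun _ => z⁻¹
  have hx0 : F (Sum.inl (0, false)) = x := by simp [F]
  have hy0 : F (Sum.inl (0, true)) = y := by simp [F]
  have hrel : ∀ w ∈ ({relator (g' + 1) 1} : Set (FreeGroup (puncturedSurfaceGen (g' + 1) 1))),
      FreeGroup.lift F w = 1 := by
    intro w hw
    rw [Set.mem_singleton_iff] at hw
    rw [hw, lift_relator]
    have h1 : ((List.finRange (g' + 1)).map fun i =>
        F (Sum.inl (i, false)) * F (Sum.inl (i, true)) * (F (Sum.inl (i, false)))⁻¹ *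
          (F (Sum.inl (i, true)))⁻¹).prod = z := by
      rw [List.finRange_succ, List.map_cons, List.prod_cons, List.map_map]
      have htail : (List.map ((fun i : Fin (g' + 1) =>
          F (Sum.inl (i, false)) * F (Sum.inl (i, true)) * (F (Sum.inl (i, false)))⁻¹ *
            (F (Sum.inl (i, true)))⁻¹) ∘ Fin.succ) (List.finRange g')).prod = 1 :=
        List.prod_eq_one fun t ht => by
          obtain ⟨i, -, rfl⟩ := List.mem_map.mp ht
          simp [F, Fin.succ_ne_zero i]
      rw [htail, mul_one, hx0, hy0]
      exact hz
    have h2 : ((List.finRange 1).map fun j => F (Sum.inr j)).prod = z⁻¹ := by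
      simp [F, List.finRange_succ]
    rw [h1, h2, mul_inv_cancel]
  have hfa : PresentedGroup.toGroup hrel (a 0) = x := by rw [a, PresentedGroup.toGroup.of, ← hx0]
  have hfb : PresentedGroup.toGroup hrel (b 0) = y := by rw [b, PresentedGroup.toGroup.of, ← hy0]
  have hfc : PresentedGroup.toGroup hrel (c 0) = z⁻¹ := by rw [c, PresentedGroup.toGroup.of]; rfl
  refine ⟨σ, PresentedGroup.toGroup hrel, hσ, fun w => ?_, hfc⟩
  -- surjectivity: `w = y^p z^q x^t` for `w = ((p,q); t)`
  refine ⟨b 0 ^ (toAdd w.left).1.val * (c 0)⁻¹ ^ (toAdd w.left).2.val * a 0 ^ (toAdd w.right).val,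
    ?_⟩
  rw [map_mul, map_mul, map_pow, map_pow, map_pow, map_inv, hfa, hfb, hfc, inv_inv]
  have hy' : y ^ (toAdd w.left).1.val * z ^ (toAdd w.left).2.val = SemidirectProduct.inl w.left := by
    change SemidirectProduct.inl (ofAdd ((1 : ZMod ℓ), (0 : ZMod ℓ))) ^ (toAdd w.left).1.val *
      SemidirectProduct.inl (ofAdd ((0 : ZMod ℓ), (1 : ZMod ℓ))) ^ (toAdd w.left).2.val = _
    rw [← map_pow SemidirectProduct.inl, ← map_pow SemidirectProduct.inl,
      ← map_mul SemidirectProduct.inl, ← ofAdd_nsmul, ← ofAdd_nsmul, ← ofAdd_add, Prod.smul_mk,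
      Prod.smul_mk, smul_zero, smul_zero, nsmul_eq_mul, nsmul_eq_mul, mul_one, mul_one,
      ZMod.natCast_zmod_val, ZMod.natCast_zmod_val, Prod.mk_add_mk, add_zero, zero_add]
    rfl
  have hx' : x ^ (toAdd w.right).val = SemidirectProduct.inr w.right := by
    change SemidirectProduct.inr (ofAdd (1 : ZMod ℓ)) ^ (toAdd w.right).val = _
    rw [← map_pow SemidirectProduct.inr, ← ofAdd_nsmul, nsmul_eq_mul, mul_one, ZMod.natCast_zmod_val]
    rfl
  rw [hy', hx', SemidirectProduct.inl_left_mul_inr_right]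

/-! ### Assembly -/

/-- **Transitive actions with freely acting cusps.** For `(g, r)` hyperbolic and `ℓ` prime: a
finite group `G` of order dividing `ℓ ^ 3`, a SURJECTION `f : Γ_{g,r} ↠ G` and a subgroup `H ⊆ G`
of index `ℓ ^ 2` such that `f(c_j) ^ ℓ = 1` and NO conjugate of any `f(c_j)` lies in `H` — i.e.
`Γ_{g,r}` acts transitively on the `ℓ ^ 2` cosets `G/H` and every cusp generator acts without fixed
points with all cycles of length `ℓ` (the same cycle type for every cusp of every hyperbolic type).
[cite: MochizukiSemiAnbd2006, Ex. 2.10 p.31] -/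
theorem exists_hom_transitive_cusps_free (h : IsHyperbolicType g r) {ℓ : ℕ} (hℓ : ℓ.Prime) :
    ∃ (G : Type) (_ : Group G) (_ : Finite G) (f : PuncturedSurfaceGroup g r →* G)
      (H : Subgroup G), Nat.card G ∣ ℓ ^ 3 ∧ Function.Surjective f ∧ H.index = ℓ ^ 2 ∧
      ∀ j, f (c j) ^ ℓ = 1 ∧ ∀ x : G, x * f (c j) * x⁻¹ ∉ H := by
  haveI : NeZero ℓ := ⟨hℓ.ne_zero⟩
  haveI : Fact (1 < ℓ) := ⟨hℓ.one_lt⟩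
  have hcardZ2 : Nat.card (Multiplicative (ZMod ℓ × ZMod ℓ)) = ℓ ^ 2 := by
    rw [Nat.card_congr Multiplicative.toAdd, Nat.card_prod, Nat.card_zmod, sq]
  by_cases hr : r = 1
  · -- the Heisenberg group
    subst hr
    have hg : 0 < g := by unfold IsHyperbolicType at h; omega
    obtain ⟨σ, f, hσ, hfs, hfc⟩ := exists_hom_heisenberg_surjective hg ℓ
    haveI : Finite (Multiplicative (ZMod ℓ × ZMod ℓ) ⋊[σ] Multiplicative (ZMod ℓ)) :=
      Finite.of_equiv _ SemidirectProduct.equivProd.symm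
    have hcardG : Nat.card (Multiplicative (ZMod ℓ × ZMod ℓ) ⋊[σ] Multiplicative (ZMod ℓ)) =
        ℓ ^ 3 := by
      rw [Nat.card_congr SemidirectProduct.equivProd, Nat.card_prod, hcardZ2,
        Nat.card_congr Multiplicative.toAdd, Nat.card_zmod, ← pow_succ]
    let y : Multiplicative (ZMod ℓ × ZMod ℓ) ⋊[σ] Multiplicative (ZMod ℓ) :=
      SemidirectProduct.inl (ofAdd (1, 0))
    have hyord : orderOf y = ℓ := by
      rw [orderOf_injective SemidirectProduct.inl SemidirectProduct.inl_injective,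
        orderOf_ofAdd_eq_addOrderOf, Prod.addOrderOf, ZMod.addOrderOf_one, addOrderOf_zero,
        Nat.lcm_one_right]
    -- `c₁ ↦ z⁻¹` is central
    have hcentral : ∀ w : Multiplicative (ZMod ℓ × ZMod ℓ) ⋊[σ] Multiplicative (ZMod ℓ),
        w * (SemidirectProduct.inl (ofAdd (0, 1)))⁻¹ * w⁻¹ =
          (SemidirectProduct.inl (ofAdd ((0 : ZMod ℓ), (1 : ZMod ℓ))))⁻¹ := by
      intro w
      conv_lhs => rw [← SemidirectProduct.inl_left_mul_inr_right w]
      rw [← map_inv, ← ofAdd_neg, Prod.neg_mk, neg_zero, mul_inv_rev, ← map_inv SemidirectProduct.inr,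
        ← map_inv SemidirectProduct.inl,
        mul_assoc (SemidirectProduct.inl w.left) (SemidirectProduct.inr w.right),
        mul_assoc (SemidirectProduct.inl w.left), ← mul_assoc (SemidirectProduct.inr w.right * _),
        ← SemidirectProduct.inl_aut, hσ, mul_zero, add_zero, ← mul_assoc,
        ← map_mul SemidirectProduct.inl, ← map_mul SemidirectProduct.inl, mul_inv_cancel_comm]
    refine ⟨_, inferInstance, inferInstance, f, Subgroup.zpowers y, dvd_of_eq hcardG, hfs, ?_,
      fun j => ⟨?_, fun w => ?_⟩⟩
    · have hH : Nat.card (Subgroup.zpowers y) = ℓ := by rw [Nat.card_zpowers, hyord]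
      have hmul := (Subgroup.zpowers y).card_mul_index
      rw [hH, hcardG, pow_succ', ] at hmul
      exact Nat.eq_of_mul_eq_mul_left hℓ.pos hmul
    · rw [Subsingleton.elim j 0, hfc, inv_pow, ← map_pow SemidirectProduct.inl, ← ofAdd_nsmul,
        nsmul_self_eq_zero, ofAdd_zero, map_one, inv_one]
    · rw [Subsingleton.elim j 0, hfc, hcentral, Subgroup.mem_zpowers_iff]
      rintro ⟨k, hk⟩
      change SemidirectProduct.inl (ofAdd ((1 : ZMod ℓ), (0 : ZMod ℓ))) ^ k = _ at hk
      rw [← map_zpow SemidirectProduct.inl, ← map_inv SemidirectProduct.inl,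
        (SemidirectProduct.inl_injective).eq_iff, ← ofAdd_zsmul, ← ofAdd_neg,
        Equiv.apply_eq_iff_eq, Prod.smul_mk, smul_zero, Prod.neg_mk, neg_zero, Prod.mk.injEq] at hk
      exact (neg_ne_zero.2 (one_ne_zero (α := ZMod ℓ))) hk.2.symm
  · -- the regular action of `(ℤ/ℓ)²`
    obtain ⟨f, hfs, hfc⟩ := exists_hom_zmod_sq_surjective h hr hℓ
    refine ⟨_, inferInstance, inferInstance, f, ⊥, ?_, hfs, by rw [Subgroup.index_bot, hcardZ2],
      fun j => ⟨?_, fun w => ?_⟩⟩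
    · rw [hcardZ2]; exact pow_dvd_pow ℓ (by norm_num)
    · rw [← ofAdd_toAdd (f (c j)), ← ofAdd_nsmul, nsmul_self_eq_zero, ofAdd_zero]
    · rw [mul_inv_cancel_comm, Subgroup.mem_bot]
      exact hfc j

end Literature.GroupTheory.CombinatorialGroupTheory.PuncturedSurfaceGroup
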